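import Summits.QuantumFields.QCD.Theses.HeatSlicedQuarks

/-!
Sketch for crux-ideate `stmt-QuantumFields-8872` (`HeatSlicedQuarks.ActionBoundsLowModes`), round 1,
ideator 3.  First lemmas of the idea cards `rumin-layer-cake-clr` and `besicovitch-cubes-kato-sobolev`.
Nothing here is proved; every `def … : Prop` only has to ELABORATE over existing declarations.

Conventions (tree, `GrassmannIntegral.lean:326`): `D_W(U,m,1) = m + ½ K_U + B` with
`K_U = D_W(U,0,1) + D_W(U,0,1)ᴴ` the covariant (gauge) Laplacian form acting trivially on spin and
`B` anti-Hermitian (`AccretiveWilsonDirac`, item 8875).  `S_W = wilsonAction ρ₃ U = Σ_p (3 − Re tr U_p)`.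
-/

open scoped Matrix ComplexConjugate BigOperators ComplexOrder
open Literature.MathematicalPhysics.QuantumFieldTheory
open Literature.MathematicalPhysics.QuantumLattice
open Literature.Probability.LatticeModels

namespace Summit.QuantumFields.QCD.Cruxes.ActionBoundsLowModes.SketchIdeator3

/-- The gauge group of the crux. -/
abbrev SU3 : Type := Matrix.specialUnitaryGroup (Fin 3) ℂ

/-- Its fundamental representation (the `ρ` of `wilsonDirac` / `wilsonAction` in the crux). -/
noncomputable abbrev ρ₃ : SU3 →* Matrix (Fin 3) (Fin 3) ℂ := fundamentalRep (Fin 3)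

/-- Quark-field index of the crux: site × colour × spin. -/
abbrev Idx (L : ℕ) : Type := TorusSite 4 L × Fin 3 × Fin 4

/-- The covariant Laplacian form `K_U ⊗ 1_spin = D_W(U,0,1) + D_W(U,0,1)ᴴ` (twice the Hermitian
part of the massless Wilson operator; `AccretiveWilsonDirac` identifies its quadratic form with
`Σ_{x,μ} ‖U(x,μ) v(x+μ̂) − v(x)‖²`). -/
noncomputable def gaugeLaplacian {L : ℕ} [NeZero L] (U : GaugeConfig 4 L SU3) :
    Matrix (Idx L) (Idx L) ℂ :=
  wilsonDirac ρ₃ U 0 1 + (wilsonDirac ρ₃ U 0 1)ᴴ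

/-! ## Shared first lemma (both cards): the mass enters only through `K_U` -/

/-- MASS-SHIFT IDENTITY (provable now, size S: `D_W(U,m,1) = D_W(U,0,1) + m·1` entrywise):
`D(m)ᴴ D(m) = D(0)ᴴ D(0) + m·K_U + m²`.  Consequences used by both cards: the count for
`m ∈ [0,1]` is dominated by `m = 0`, and for `m ∈ [−½,0)` one needs only the `m = 0` Weitzenböck
bound `D(0)ᴴD(0) ≥ K_U − C·V` (coefficient exactly 1), i.e. `WilsonLichnerowicz` at `m = 0`. -/
def MassShiftIdentity : Prop :=
  ∀ (L : ℕ) [NeZero L] (U : GaugeConfig 4 L SU3) (m : ℝ),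
    (wilsonDirac ρ₃ U m 1)ᴴ * wilsonDirac ρ₃ U m 1 =
      (wilsonDirac ρ₃ U 0 1)ᴴ * wilsonDirac ρ₃ U 0 1 + (m : ℂ) • gaugeLaplacian U +
        ((m : ℂ) ^ 2) • (1 : Matrix (Idx L) (Idx L) ℂ)

/-! ## Card `rumin-layer-cake-clr` -/

/-- First lemma (A1), DIAMAGNETIC DIAGONAL BOUND (size M): the on-diagonal colour–spin entries of
`e^{−t K_U}` are bounded by the FREE torus return probability, uniformly in the SU(3) field:
`|e^{−tK_U}((x,a,α),(x,b,β))| ≤ C (t⁻² + L⁻⁴)` for all `t > 0`.  Proof route: `K_U = 8 − A_U`,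
Dyson/power series of `NormedSpace.exp`, `‖(A_Uⁿ)(x,y)‖ ≤ #paths = (A_1ⁿ)(x,y)` (unitary parallel
transports), then the product of four 1-D cosine sums for the free kernel. -/
def DiamagneticDiagonal : Prop :=
  ∃ C : ℝ, ∀ (L : ℕ) [NeZero L] (U : GaugeConfig 4 L SU3) (t : ℝ), 0 < t →
    ∀ (x : TorusSite 4 L) (a b : Fin 3) (α β : Fin 4),
      ‖(NormedSpace.exp (-(t : ℂ) • gaugeLaplacian U)) (x, a, α) (x, b, β)‖ ≤
        C * (1 / t ^ 2 + 1 / (L : ℝ) ^ 4)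

/-- First lemma (A2), the ENGINE — ABSTRACT FINITE-DIMENSIONAL CLR IN SPECTRAL DIMENSION 4
(Frank–Rumin layer-cake form; size L, pure linear algebra): for a positive semidefinite Hermitian
matrix `H` on `ℓ²(X × F)` whose low-energy vectors are uniformly spread — every `u` in a subspace
of Rayleigh quotient `≤ E` has `Σ_f |u(x,f)|² ≤ A E² ‖u‖²` at every `x` — and every `W ≥ 0` on `X`,
any subspace on which `⟨u,Hu⟩ ≤ Σ_x W(x) |u(x)|²` has dimension `≤ C · |F| · A · Σ_x W(x)²`.
(Hypothesis = diagonal of the spectral projectors `tr 1(H<E)(x,x) ≤ |F| A E²`; NO positivity /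
Markov property of `e^{−tH}` is assumed — that is the point of the lever.) -/
def AbstractCLR4 : Prop :=
  ∃ C : ℝ, ∀ (X F : Type) [Fintype X] [DecidableEq X] [Fintype F] [DecidableEq F]
    (H : Matrix (X × F) (X × F) ℂ), H.PosSemidef → ∀ (A : ℝ), 0 ≤ A →
    (∀ (E : ℝ), 0 < E → ∀ (S : Submodule ℂ (X × F → ℂ)),
        (∀ u ∈ S, (∑ i, star (u i) * H.mulVec u i).re ≤ E * ∑ i, ‖u i‖ ^ 2) →
          ∀ u ∈ S, ∀ x : X, ∑ f : F, ‖u (x, f)‖ ^ 2 ≤ A * E ^ 2 * ∑ i, ‖u i‖ ^ 2) →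
    ∀ (W : X → ℝ), (∀ x, 0 ≤ W x) → ∀ (S : Submodule ℂ (X × F → ℂ)),
      (∀ u ∈ S, (∑ i, star (u i) * H.mulVec u i).re ≤ ∑ x, W x * ∑ f, ‖u (x, f)‖ ^ 2) →
        (Module.finrank ℂ S : ℝ) ≤ C * (Fintype.card F : ℝ) * A * ∑ x, (W x) ^ 2

/-- The ENGINE behind (A2), isolated (Frank 2014 §1 "impatient reader" + Thm 3.2 sketch, finite-dimensional
form; size M): under the same spread hypothesis, every finite family `ψ₁ … ψₙ` that is ORTHONORMAL FOR THE
ENERGY FORM `⟨ψ_j, H ψ_k⟩ = δ_jk` (equivalently `0 ≤ γ := Σ|ψ_j⟩⟨ψ_j| ≤ H⁻¹`) has squared density summable against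
itself: `Σ_x (Σ_j Σ_f |ψ_j(x,f)|²)² ≤ C |F| A n`.  Proof = layer cake over the eigenvalues of `H` with the
pointwise split `γ(x,x) ≤ 2(P_E γ P_E)(x,x) + 2 (H⁻¹ 1(H≤E))(x,x)`; (A2) follows in three lines (Gram–Schmidt in
the energy inner product on a subspace where `H ≤ W`, then `n ≤ Σ_x W ρ ≤ ‖W‖₂ ‖ρ‖₂ ≤ ‖W‖₂ (C|F|A n)^{1/2}`). -/
def RuminFrankKinetic : Prop :=
  ∃ C : ℝ, ∀ (X F : Type) [Fintype X] [DecidableEq X] [Fintype F] [DecidableEq F]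
    (H : Matrix (X × F) (X × F) ℂ), H.PosSemidef → ∀ (A : ℝ), 0 ≤ A →
    (∀ (E : ℝ), 0 < E → ∀ (S : Submodule ℂ (X × F → ℂ)),
        (∀ u ∈ S, (∑ i, star (u i) * H.mulVec u i).re ≤ E * ∑ i, ‖u i‖ ^ 2) →
          ∀ u ∈ S, ∀ x : X, ∑ f : F, ‖u (x, f)‖ ^ 2 ≤ A * E ^ 2 * ∑ i, ‖u i‖ ^ 2) →
    ∀ (n : ℕ) (ψ : Fin n → X × F → ℂ),
      (∀ j k : Fin n, (∑ i, star (ψ j i) * H.mulVec (ψ k) i) = if j = k then 1 else 0) →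
        ∑ x : X, (∑ j : Fin n, ∑ f : F, ‖ψ j (x, f)‖ ^ 2) ^ 2 ≤ C * (Fintype.card F : ℝ) * A * n

/-- How (A1) + (A2) + `WilsonLichnerowicz` close the crux (the composition a crux-plan would check):
apply (A2) to `H := ½ K_U + L⁻²` on `X := TorusSite 4 L`, `F := Fin 3 × Fin 4`, whose spread
constant `A` is absolute by (A1) (`1(H<E) ≤ e·e^{−H/E}` and `L⁻⁴ ≤ E²` whenever `1(H<E) ≠ 0`), with
`W := C·V_F + λ + L⁻²`; then `Σ W² ≤ 3(C² Σ V_F² + λ² L⁴ + 1)` and `Σ V_F² ≤ C' S_W`.  Recorded as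
the target shape only. -/
def MagneticDiscreteCLRPlusOne : Prop :=
  ∃ C : ℝ, ∀ (L : ℕ) [NeZero L] (U : GaugeConfig 4 L SU3) (W : TorusSite 4 L → ℝ), (∀ x, 0 ≤ W x) →
    ∀ (S : Submodule ℂ (Idx L → ℂ)),
      (∀ u ∈ S, (1 / 2 : ℝ) * (∑ i, star (u i) * (gaugeLaplacian U).mulVec u i).re ≤
          ∑ x, W x * ∑ a : Fin 3, ∑ α : Fin 4, ‖u (x, a, α)‖ ^ 2) →
        (Module.finrank ℂ S : ℝ) ≤ C * (∑ x, (W x) ^ 2 + 1)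

/-! ## Card `besicovitch-cubes-kato-sobolev` -/

/-- First lemma (B1), KATO'S INEQUALITY FOR FORMS on the bundle (provable now, size S; one line per
link: `‖U v(y) − v(x)‖ ≥ |‖v(y)‖ − ‖v(x)‖|` for unitary `U`): the covariant Laplacian form dominates
the FREE Laplacian form of the pointwise colour–spin norm. -/
def KatoForms : Prop :=
  ∀ (L : ℕ) [NeZero L] (U : GaugeConfig 4 L SU3) (v : Idx L → ℂ),
    ∑ x : TorusSite 4 L, ∑ μ : Fin 4,
        (Real.sqrt (∑ a : Fin 3, ∑ α : Fin 4, ‖v (Site.shift x μ, a, α)‖ ^ 2) -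
          Real.sqrt (∑ a : Fin 3, ∑ α : Fin 4, ‖v (x, a, α)‖ ^ 2)) ^ 2 ≤
      ∑ x : TorusSite 4 L, ∑ μ : Fin 4, ∑ a : Fin 3, ∑ α : Fin 4,
        ‖(∑ b : Fin 3, (ρ₃ (U (x, μ))) a b * v (Site.shift x μ, b, α)) - v (x, a, α)‖ ^ 2

/-- First lemma (B2), SCALE-FREE DISCRETE SOBOLEV–POINCARÉ on the 4-torus (size M; the cube version
with `L ↦ side ℓ` and Neumann sums is the one the covering uses): `‖f‖₄² ≤ C_S (K₀[f] + L⁻² ‖f‖₂²)`. -/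
def TorusSobolev4 : Prop :=
  ∃ CS : ℝ, ∀ (L : ℕ) [NeZero L] (f : TorusSite 4 L → ℝ),
    Real.sqrt (∑ x, f x ^ 4) ≤
      CS * (∑ x, ∑ μ : Fin 4, (f (Site.shift x μ) - f x) ^ 2 + (1 / (L : ℝ) ^ 2) * ∑ x, f x ^ 2)

/-- First lemma (B3) = the ONE-CUBE LEMMA in its whole-torus instance, a literal special case of the
crux with explicit smallness (size M given B1, B2, A1): if the total budget `λ² L⁴ + S_W(U)` is below
an absolute `ε₀`, at most `C₀` independent quark fields have `‖D_W v‖² ≤ λ ‖v‖²`.  (Kato + Hölder +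
Sobolev–Poincaré force every such `v` below the first magnetic level `κ₀/L²`; the diamagnetic
trace-Weyl bound `N(K_U ≤ κ) ≤ 12e·Σ_x e^{−K₁/κ}(x,x) ≤ C(κ²L⁴ + 1)` counts them.)  The general crux is
this lemma on Besicovitch-selected cubes each carrying `ε₀` of `Σ (C V_F + λ)²`. -/
def SmallBudgetFewModes : Prop :=
  ∃ ε₀ : ℝ, 0 < ε₀ ∧ ∃ C₀ : ℝ, ∀ (L : ℕ) [NeZero L] (U : GaugeConfig 4 L SU3) (m : ℝ),
    m ∈ Set.Icc (-(1 / 2 : ℝ)) 1 → ∀ (lam : ℝ), 0 ≤ lam →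
      lam ^ 2 * (L : ℝ) ^ 4 + wilsonAction ρ₃ U ≤ ε₀ →
        ∀ (E : Submodule ℂ (Idx L → ℂ)),
          (∀ v ∈ E, ∑ i, ‖(wilsonDirac ρ₃ U m 1).mulVec v i‖ ^ 2 ≤ lam * ∑ i, ‖v i‖ ^ 2) →
            (Module.finrank ℂ E : ℝ) ≤ C₀

/-! ## Card `weyl-action-split` (reduction lever shared by every engine) -/

/-- The local curvature weight of `WilsonLichnerowicz` (8874): `V_F(x) = Σ_{y : dist(x,y) ≤ 3} Σ_{μ,ν}
√(3 − Re tr U_{y,μν})`, copied verbatim from the route file so that `Σ_x V_F(x)² ≤ C·S_W(U)`. -/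
noncomputable def curvatureWeight {L : ℕ} [NeZero L] (U : GaugeConfig 4 L SU3) (x : TorusSite 4 L) : ℝ :=
  ∑ y ∈ Finset.univ.filter (fun y : TorusSite 4 L => torusDist x y ≤ 3), ∑ μ : Fin 4, ∑ ν : Fin 4,
    Real.sqrt (3 - ((ρ₃ (plaquetteHolonomy U y μ ν)).trace).re)

/-- First lemma (C1), DIAMAGNETIC WEYL LAW (size S/M; elementary and SHARP for a pure kinetic operator):
the number of independent quark fields with covariant kinetic energy `½K_U[u] ≤ κ‖u‖²` is at most
`C(κ²L⁴ + 1)`, uniformly in the SU(3) field — `N(K_U ≤ 2κ) ≤ e·Tr e^{−K_U/(2κ)} ≤ 12e Σ_x p_{1/2κ}(x,x)`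
by Kato domination of the TRACE and the free torus return bound.  This is the whole `λ²L⁴` of the crux. -/
def DiamagneticWeyl : Prop :=
  ∃ C : ℝ, ∀ (L : ℕ) [NeZero L] (U : GaugeConfig 4 L SU3) (κ : ℝ), 0 ≤ κ →
    ∀ (S : Submodule ℂ (Idx L → ℂ)),
      (∀ u ∈ S, (1 / 2 : ℝ) * (∑ i, star (u i) * (gaugeLaplacian U).mulVec u i).re ≤ κ * ∑ i, ‖u i‖ ^ 2) →
        (Module.finrank ℂ S : ℝ) ≤ C * (κ ^ 2 * (L : ℝ) ^ 4 + 1)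

/-- First lemma (C2) = the TRANSFER target `C⁰`, ZERO-ENERGY MAGNETIC BINDING BY CURVATURE (the entire
CLR content of the crux, with `λ` and `L⁴` gone): at coupling `g`, the zero-energy bound states of the
comparison operator `½K_U − g·V_F` number at most `C(g² S_W(U) + 1)`. -/
def ZeroEnergyBinding : Prop :=
  ∃ C : ℝ, ∀ (L : ℕ) [NeZero L] (U : GaugeConfig 4 L SU3) (g : ℝ), 0 ≤ g →
    ∀ (S : Submodule ℂ (Idx L → ℂ)),
      (∀ u ∈ S, (1 / 2 : ℝ) * (∑ i, star (u i) * (gaugeLaplacian U).mulVec u i).re ≤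
          g * ∑ x, curvatureWeight U x * ∑ a : Fin 3, ∑ α : Fin 4, ‖u (x, a, α)‖ ^ 2) →
        (Module.finrank ℂ S : ℝ) ≤ C * (g ^ 2 * wilsonAction ρ₃ U + 1)

/-- The split (codimension subadditivity of nonpositive cones for `q = (θ·½K_U − λ) + ((1−θ)·½K_U − C·V_F)`,
`θ = ½`, after `WilsonLichnerowicz` turns the crux hypothesis into `½K_U ≤ C·V_F + λ` on `E`): the crux is
the conjunction of the kinematic (C1) and the dynamical (C2).  Stated as the glue claim a crux-plan checks. -/
def WeylActionSplit : Prop :=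
  DiamagneticWeyl → ZeroEnergyBinding →
    Summit.QuantumFields.QCD.Theses.HeatSlicedQuarks.WilsonLichnerowicz →
      Summit.QuantumFields.QCD.Theses.HeatSlicedQuarks.ActionBoundsLowModes

/-- Sanity: (B3) is implied by the crux (take `C₀ := 2·max C 0`), so it cannot be harder.
(`wilsonAction ≥ 0` — `|Re tr U_p| ≤ 3` for SU(3) — is taken as a hypothesis to keep this
one-screen.) -/
theorem smallBudget_of_crux
    (h : Summit.QuantumFields.QCD.Theses.HeatSlicedQuarks.ActionBoundsLowModes)
    (hpos : ∀ (L : ℕ) [NeZero L] (U : GaugeConfig 4 L SU3), 0 ≤ wilsonAction ρ₃ U) :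
    SmallBudgetFewModes := by
  obtain ⟨C, hC⟩ := h
  refine ⟨1, one_pos, max C 0 * 2, ?_⟩
  intro L _ U m hm lam hlam hbudget E hE
  have h1 := hC L U m hm lam hlam E hE
  have hB : 0 ≤ lam ^ 2 * (L : ℝ) ^ 4 + wilsonAction ρ₃ U := by
    have := hpos L U
    positivity
  calc (Module.finrank ℂ E : ℝ) ≤ C * (lam ^ 2 * (L : ℝ) ^ 4 + wilsonAction ρ₃ U + 1) := h1
    _ ≤ max C 0 * (lam ^ 2 * (L : ℝ) ^ 4 + wilsonAction ρ₃ U + 1) := by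
        apply mul_le_mul_of_nonneg_right (le_max_left _ _); linarith
    _ ≤ max C 0 * 2 := by
        apply mul_le_mul_of_nonneg_left _ (le_max_right _ _); linarith

end Summit.QuantumFields.QCD.Cruxes.ActionBoundsLowModes.SketchIdeator3
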